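import Summits.QuantumFields.YangMills.Theorems.SwapVirialDeficitSectorLaplaceBTubeStiffness
import Summits.QuantumFields.YangMills.Theorems.SwapVirialDeficitSectorLaplaceBTubeHubCot
import HarnessLib

/-!
# STUB (S-B) OF SKELETON ➎: THE CAPPED B-TUBE IN THE LETTERS `(δ, η)` — its region contains the scaled tube, sits in the cylinder, and the stiffness follows
# (free-hands support of ⟨stmt-QuantumFields-24197⟩ `SwapVirialDeficit.SwapGluedStiffness` ∕ ⟨24194⟩; cell ym-idea-1, LEAD g99 ruling 2026-08-31 20:48Z ∕ 20:59Z: ✓`BTubeCap L τ X₁`)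

The `(δ, η)`-image of ✓`BTubeCap L τ X₁` (✓`mem_BTube_iff_cot` plus the cap, which does not see the hub) is the region
`RgCap = {δ ∈ W_τ} ∩ {τ ≤ √(η_x1² + η_x2²)} ∩ {|η_x0| ≤ X₁√(1 + η_x1² + η_x2²)}`.  This file checks the two geometric hypotheses of ✓`bTube_stiff_of_farFloor` for it and
instantiates:
* `measurableSet_bCapRegion`; `bCapRegion_subset_cylinder` (`τ ≤ √s ⟹ τ² ≤ s`); ★ `scaledTube_subset_bCapRegion` — for `0 < τ ≤ ½`, `R ≤ X₁`, `2R < τ`: every scaled-tube point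
  `Ψ′_B(u, y)` (`τ² ≤ |u|²`, `‖y‖ ≤ R`) lies in `RgCap` (`|δ| ≤ ‖y‖`: ✓`abs_delta_gnoScaleBChart_le`; base `u`: ✓`base_gnoScaleBChart`; axial letter `√(1+|u|²)·|y_{x₀}| ≤ X₁√(1+|u|²)`:
  ✓`abs_axial_gnoScaleBChart`);
* ★★★ `bTubeCap_stiff_of_farFloor` — ✓`bTube_stiff_of_farFloor` on `RgCap`: principal signs, `0 < τ ≤ ½`, `0 < R ≤ X₁`, `2R < τ`, `1136016L⁴R ≤ λ_B∕(8(m_B+8))`, `2R² ≤ 1`,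
  the FAR FLOOR on `RgCap` off the tube (w3 g67), `b ≥ 1` with the two explicit smallness conditions ⟹
  `stiffKappa L (1∕8) · ∫_{RgCap} e^{−bF_B} dμ_B ≤ b · ∫_{RgCap} F_B e^{−bF_B} dμ_B` — by ✓`setIntegral_BTube(Cap)_exp∕action_eq_hubCot` these are g47's `stub_B_stiff` integrals
  over `BTubeCap L τ X₁` up to the common factor `coneConst·π`.

HONEST LABEL: (S-B) is NOT closed (far floor on the capped tube [w3 g67]; the `BTubeCap` reading twin of ✓`setIntegral_BTube_exp_eq_hubCot`; threshold bookkeeping); (S-core), (S-001),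
⟨24197⟩ ∕ ⟨24194⟩ OPEN; own crux ⟨22884⟩ OPEN (blocked-on ⟨19935⟩); the Yang–Mills mass gap is NOT proved; no summit is proved by a line.  THEOREMS ONLY (0 `def`, 0 `sorry`), standard
axioms.  Width seat ym-line-sfw-p2-w2 g59 (cell ym-idea-1, free hands), `--supports stmt-QuantumFields-24197`.  References: [cite: Luscher1983, §2]; [folklore].
-/

set_option autoImplicit false
set_option synthInstance.maxSize 1024

noncomputable section

open MeasureTheory Quaternion Set Metric Module
open scoped Quaternion BigOperators ENNReal InnerProductSpace
open Literature.MathematicalPhysics.QuantumLattice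
open Literature.MathematicalPhysics.QuantumFieldTheory hiding SU2
open Summit.QuantumFields.YangMills.Theorems.SwapTwistDeficit.ToronLog

namespace Summit.QuantumFields.YangMills.Theorems.SwapVirialDeficit.BlowUpRing

open Summit.QuantumFields.YangMills.Theorems.FemtoTransferGap
open Summit.QuantumFields.YangMills.Theorems.FemtoTransferGap.TT
open Summit.QuantumFields.YangMills.Theorems.VirialFluxGap.RingDeficit
open Summit.QuantumFields.YangMills.Theorems.SwapVirialDeficit.SwapRing
open Summit.QuantumFields.YangMills.Theorems.SwapVirialDeficit.SectorLaplace
open Summit.QuantumFields.YangMills.Theorems.SwapVirialDeficit.Gnomonic (normSq3 normSq3_nonneg gnomonicWeight gnomonicWeight_pos)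

variable {L : ℕ} [NeZero L]

/-! ## §1 The capped region in the letters `(δ, η)` -/

omit [NeZero L] in
/-- The capped region is measurable. [folklore] -/
theorem measurableSet_bCapRegion (τ X₁ : ℝ) :
    MeasurableSet ({p : ℝ × GnoCoord L | 4 * p.1 ^ 2 / (1 + p.1 ^ 2) ^ 2 < τ ∧ τ ≤ (1 + p.1 ^ 2)⁻¹ ∧ |p.1| < τ * Real.sqrt (1 + p.1 ^ 2)} ∩
            {p : ℝ × GnoCoord L | τ ≤ Real.sqrt (p.2.1.1 1 ^ 2 + p.2.1.1 2 ^ 2)} ∩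
            {p : ℝ × GnoCoord L | |p.2.1.1 0| ≤ X₁ * Real.sqrt (1 + p.2.1.1 1 ^ 2 + p.2.1.1 2 ^ 2)}) := by
  refine (measurableSet_bWindowCylinder (L := L) τ).inter (measurableSet_le ?_ ?_)
  · exact ((measurable_pi_apply 0).comp (measurable_fst.comp (measurable_fst.comp measurable_snd))).abs
  · exact measurable_const.mul ((measurable_const.add (((measurable_pi_apply 1).comp (measurable_fst.comp (measurable_fst.comp measurable_snd))).pow_const 2)).add
      (((measurable_pi_apply 2).comp (measurable_fst.comp (measurable_fst.comp measurable_snd))).pow_const 2)).sqrt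

omit [NeZero L] in
/-- The capped region sits in the cylinder over `S_τ = {τ² ≤ |u|²}` (`0 < τ`). [folklore] -/
theorem bCapRegion_subset_cylinder {τ : ℝ} (hτ : 0 < τ) (X₁ : ℝ) :
    ({p : ℝ × GnoCoord L | 4 * p.1 ^ 2 / (1 + p.1 ^ 2) ^ 2 < τ ∧ τ ≤ (1 + p.1 ^ 2)⁻¹ ∧ |p.1| < τ * Real.sqrt (1 + p.1 ^ 2)} ∩
            {p : ℝ × GnoCoord L | τ ≤ Real.sqrt (p.2.1.1 1 ^ 2 + p.2.1.1 2 ^ 2)} ∩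
            {p : ℝ × GnoCoord L | |p.2.1.1 0| ≤ X₁ * Real.sqrt (1 + p.2.1.1 1 ^ 2 + p.2.1.1 2 ^ 2)}) ⊆
      {p : ℝ × GnoCoord L | τ ^ 2 ≤ p.2.1.1 1 ^ 2 + p.2.1.1 2 ^ 2} := by
  intro p hp
  have h := hp.1.2
  have h0 : 0 ≤ p.2.1.1 1 ^ 2 + p.2.1.1 2 ^ 2 := by positivity
  show τ ^ 2 ≤ p.2.1.1 1 ^ 2 + p.2.1.1 2 ^ 2
  exact (Real.le_sqrt hτ.le h0).1 h

/-- ★ **THE SCALED TUBE SITS IN THE CAPPED REGION**: for `0 < τ ≤ ½`, `R ≤ X₁`, `2R < τ`, every `Ψ′_B(u, y)` with `τ² ≤ |u|²` and `‖y‖ ≤ R` lies in `RgCap`. [folklore] -/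
theorem scaledTube_subset_bCapRegion {τ X₁ R : ℝ} (hτ : 0 < τ) (hτ2 : τ ≤ 1 / 2) (hRX : R ≤ X₁) (hRτ : 2 * R < τ)
    (u : ℝ × ℝ) (hu : τ ^ 2 ≤ u.1 ^ 2 + u.2 ^ 2) (y : GnoFibreB L) (hy : ‖y‖ ≤ R) :
    gnoFibreBEquiv (u, gnoScaleB u y) ∈
      ({p : ℝ × GnoCoord L | 4 * p.1 ^ 2 / (1 + p.1 ^ 2) ^ 2 < τ ∧ τ ≤ (1 + p.1 ^ 2)⁻¹ ∧ |p.1| < τ * Real.sqrt (1 + p.1 ^ 2)} ∩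
            {p : ℝ × GnoCoord L | τ ≤ Real.sqrt (p.2.1.1 1 ^ 2 + p.2.1.1 2 ^ 2)} ∩
            {p : ℝ × GnoCoord L | |p.2.1.1 0| ≤ X₁ * Real.sqrt (1 + p.2.1.1 1 ^ 2 + p.2.1.1 2 ^ 2)}) := by
  have hδ : |(gnoFibreBEquiv (u, gnoScaleB u y)).1| ≤ R := (abs_delta_gnoScaleBChart_le u y).trans hy
  have hbase := base_gnoScaleBChart (L := L) u y
  have hb1 : (gnoFibreBEquiv (u, gnoScaleB u y)).2.1.1 1 = u.1 := congrArg Prod.fst hbase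
  have hb2 : (gnoFibreBEquiv (u, gnoScaleB u y)).2.1.1 2 = u.2 := congrArg Prod.snd hbase
  obtain ⟨-, hax⟩ := abs_axial_gnoScaleBChart (L := L) u y
  set δ : ℝ := (gnoFibreBEquiv (u, gnoScaleB u y)).1 with hδdef
  have hR0 : 0 ≤ R := le_trans (norm_nonneg y) hy
  have hδ2 : δ ^ 2 ≤ R ^ 2 := by
    have := abs_le.1 hδ
    nlinarith [this.1, this.2]
  have hτ1 : τ ≤ 1 := by linarith
  refine ⟨⟨⟨?_, ?_, ?_⟩, ?_⟩, ?_⟩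
  · -- `4δ²/(1+δ²)² < τ`
    have h1 : 4 * δ ^ 2 / (1 + δ ^ 2) ^ 2 ≤ 4 * δ ^ 2 := by
      refine div_le_self (by positivity) ?_
      nlinarith [sq_nonneg δ]
    have h2 : 4 * R ^ 2 < τ := by nlinarith
    linarith
  · -- `τ ≤ (1+δ²)⁻¹`
    rw [le_inv_comm₀ hτ (by positivity)]
    have h1 : (2 : ℝ) ≤ τ⁻¹ := by rw [le_inv_comm₀ (by norm_num) hτ]; linarith
    nlinarith
  · -- `|δ| < τ√(1+δ²)`
    have h1 : 1 ≤ Real.sqrt (1 + δ ^ 2) := Real.one_le_sqrt.2 (by nlinarith [sq_nonneg δ])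
    calc |δ| ≤ R := hδ
      _ < τ := by linarith
      _ ≤ τ * Real.sqrt (1 + δ ^ 2) := le_mul_of_one_le_right hτ.le h1
  · -- the base
    show τ ≤ Real.sqrt ((gnoFibreBEquiv (u, gnoScaleB u y)).2.1.1 1 ^ 2 + (gnoFibreBEquiv (u, gnoScaleB u y)).2.1.1 2 ^ 2)
    rw [hb1, hb2]
    exact (Real.le_sqrt hτ.le (by positivity)).2 hu
  · -- the cap
    show |(gnoFibreBEquiv (u, gnoScaleB u y)).2.1.1 0| ≤ X₁ * Real.sqrt (1 + (gnoFibreBEquiv (u, gnoScaleB u y)).2.1.1 1 ^ 2 + (gnoFibreBEquiv (u, gnoScaleB u y)).2.1.1 2 ^ 2)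
    rw [hb1, hb2, show (1 : ℝ) + u.1 ^ 2 + u.2 ^ 2 = 1 + (u.1 ^ 2 + u.2 ^ 2) by ring]
    have hc0 : 0 ≤ Real.sqrt (1 + (u.1 ^ 2 + u.2 ^ 2)) := Real.sqrt_nonneg _
    calc |(gnoFibreBEquiv (u, gnoScaleB u y)).2.1.1 0| ≤ Real.sqrt (1 + (u.1 ^ 2 + u.2 ^ 2)) * ‖y‖ := hax
      _ ≤ Real.sqrt (1 + (u.1 ^ 2 + u.2 ^ 2)) * X₁ := mul_le_mul_of_nonneg_left (hy.trans hRX) hc0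
      _ = X₁ * Real.sqrt (1 + (u.1 ^ 2 + u.2 ^ 2)) := mul_comm _ _

/-! ## §2 The capped B-tube stiffness modulo the far floor -/

/-- ★★★ **THE CAPPED B-TUBE STIFFNESS MODULO THE FAR FLOOR**: ✓`bTube_stiff_of_farFloor` on the `(δ, η)`-image of ✓`BTubeCap L τ X₁` — principal signs, `0 < τ ≤ ½`,
`0 < R ≤ X₁`, `2R < τ`, `1136016L⁴R ≤ λ_B∕(8(m_B+8))`, `2R² ≤ 1`, the FAR FLOOR on the capped region off the scaled tube, `b ≥ 1` with
`K₃∕√b + K₄∕b + b^{−1∕4} ≤ 1∕(20000L⁴)` and `e^{−tλ_B R²}U₀ ≤ t^{−1∕4}(2π∕t)^{m_B∕2}M₀` on `[b, 2b]`: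
`stiffKappa L (1∕8) · ∫_{RgCap} e^{−bF_B} dμ_B ≤ b · ∫_{RgCap} F_B e^{−bF_B} dμ_B`. [cite: Luscher1983, §2] -/
theorem bTubeCap_stiff_of_farFloor (ε : GnoSign L) (hz : ε.2.1 = true) (hε : ε.2.2 = fun _ => true) {τ : ℝ} (hτ : 0 < τ) (hτ2 : τ ≤ 1 / 2)
    {X₁ R b : ℝ} (hR : 0 < R) (hRX : R ≤ X₁) (hRτ : 2 * R < τ)
    (hsmall : 1136016 * (L : ℝ) ^ 4 * R ≤ τ ^ 2 / ((1 + τ ^ 2) * (12375 * (L : ℝ) ^ 10)) / (8 * ((finrank ℝ (GnoFibreB L) : ℝ) + 8))) (hDR : 2 * R * R ≤ 1)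
    (hfar : ∀ u : ℝ × ℝ, τ ^ 2 ≤ u.1 ^ 2 + u.2 ^ 2 → ∀ y : GnoFibreB L, R ≤ ‖y‖ → gnoFibreBEquiv (u, gnoScaleB u y) ∈
      ({p : ℝ × GnoCoord L | 4 * p.1 ^ 2 / (1 + p.1 ^ 2) ^ 2 < τ ∧ τ ≤ (1 + p.1 ^ 2)⁻¹ ∧ |p.1| < τ * Real.sqrt (1 + p.1 ^ 2)} ∩
            {p : ℝ × GnoCoord L | τ ≤ Real.sqrt (p.2.1.1 1 ^ 2 + p.2.1.1 2 ^ 2)} ∩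
            {p : ℝ × GnoCoord L | |p.2.1.1 0| ≤ X₁ * Real.sqrt (1 + p.2.1.1 1 ^ 2 + p.2.1.1 2 ^ 2)}) →
      τ ^ 2 / ((1 + τ ^ 2) * (12375 * (L : ℝ) ^ 10)) * R ^ 2 ≤
        gnoDeficit (fun _ => false) (fun _ => 1) (hubAt (gnoFibreBEquiv (u, gnoScaleB u y)).1 1) ε (gnoFibreBEquiv (u, gnoScaleB u y)).2)
    (hb1 : 1 ≤ b)
    (hrate : (16 * (1136016 * (L : ℝ) ^ 4) * ((finrank ℝ (GnoFibreB L) : ℝ) + 8) / (τ ^ 2 / ((1 + τ ^ 2) * (12375 * (L : ℝ) ^ 10))) +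
          256 * (1136016 * (L : ℝ) ^ 4) * ((finrank ℝ (GnoFibreB L) : ℝ) + 8) ^ 2 / (τ ^ 2 / ((1 + τ ^ 2) * (12375 * (L : ℝ) ^ 10))) ^ 2 + 2 * R +
          8 * (2 * R) * ((finrank ℝ (GnoFibreB L) : ℝ) + 8) / (τ ^ 2 / ((1 + τ ^ 2) * (12375 * (L : ℝ) ^ 10)))) / Real.sqrt b +
        16 * ((finrank ℝ (GnoFibreB L) : ℝ) + 8) / (τ ^ 2 / ((1 + τ ^ 2) * (12375 * (L : ℝ) ^ 10)) * R ^ 2) / b + b ^ (-(1 / 4 : ℝ)) ≤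
      1 / (20000 * (L : ℝ) ^ 4))
    (habs : ∀ t : ℝ, b ≤ t → t ≤ 2 * b →
      Real.exp (-(t * (τ ^ 2 / ((1 + τ ^ 2) * (12375 * (L : ℝ) ^ 10)) * R ^ 2))) * (Real.pi * Real.exp (|Real.log (coneConst ^ 3 / 64)| + 18 * (L : ℝ) ^ 4)) ≤
        t ^ (-(1 / 4 : ℝ)) * ((2 * Real.pi / t) ^ ((finrank ℝ (GnoFibreB L) : ℝ) / 2) * ((4 / 81) / Real.sqrt ((39984 * (L : ℝ) ^ 4) ^ finrank ℝ (GnoFibreB L))))) :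
    stiffKappa L (1 / 8) *
        ∫ p in ({p : ℝ × GnoCoord L | 4 * p.1 ^ 2 / (1 + p.1 ^ 2) ^ 2 < τ ∧ τ ≤ (1 + p.1 ^ 2)⁻¹ ∧ |p.1| < τ * Real.sqrt (1 + p.1 ^ 2)} ∩
            {p : ℝ × GnoCoord L | τ ≤ Real.sqrt (p.2.1.1 1 ^ 2 + p.2.1.1 2 ^ 2)} ∩
            {p : ℝ × GnoCoord L | |p.2.1.1 0| ≤ X₁ * Real.sqrt (1 + p.2.1.1 1 ^ 2 + p.2.1.1 2 ^ 2)}), Real.exp (-(b * gnoDeficit (fun _ => false) (fun _ => 1) (hubAt p.1 1) ε p.2))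
          ∂((volume : Measure (ℝ × GnoCoord L)).withDensity fun p => ENNReal.ofReal (((1 + p.1 ^ 2)⁻¹) ^ 2 * gnoDensity p.2)) ≤
      b * ∫ p in ({p : ℝ × GnoCoord L | 4 * p.1 ^ 2 / (1 + p.1 ^ 2) ^ 2 < τ ∧ τ ≤ (1 + p.1 ^ 2)⁻¹ ∧ |p.1| < τ * Real.sqrt (1 + p.1 ^ 2)} ∩
            {p : ℝ × GnoCoord L | τ ≤ Real.sqrt (p.2.1.1 1 ^ 2 + p.2.1.1 2 ^ 2)} ∩
            {p : ℝ × GnoCoord L | |p.2.1.1 0| ≤ X₁ * Real.sqrt (1 + p.2.1.1 1 ^ 2 + p.2.1.1 2 ^ 2)}),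
          gnoDeficit (fun _ => false) (fun _ => 1) (hubAt p.1 1) ε p.2 *
          Real.exp (-(b * gnoDeficit (fun _ => false) (fun _ => 1) (hubAt p.1 1) ε p.2))
          ∂((volume : Measure (ℝ × GnoCoord L)).withDensity fun p => ENNReal.ofReal (((1 + p.1 ^ 2)⁻¹) ^ 2 * gnoDensity p.2)) :=
  bTube_stiff_of_farFloor ε hz hε hτ hτ2 (measurableSet_bCapRegion τ X₁) hR
    (fun u hu y hy => scaledTube_subset_bCapRegion hτ hτ2 hRX hRτ u hu y hy) (bCapRegion_subset_cylinder hτ X₁) hsmall hDR hfar hb1 hrate habs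

end Summit.QuantumFields.YangMills.Theorems.SwapVirialDeficit.BlowUpRing

end
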